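import Summits.Ventures.Crystal3D.Theorems.StickyWulffConstantPolycrystalWulffBoundRungTwinFreeTwoClassesCharged
import Summits.Ventures.Crystal3D.Theorems.StickyWulffConstantPolycrystalWulffBoundGenericTwoGrainFact
import Summits.Ventures.Crystal3D.Theorems.StickyWulffConstantPolycrystalWulffBoundNearTwinReduction

/-!
# `PolycrystalWulffBound`, line `PolyDensity`: the GENERIC TWO-GRAIN INEQUALITY at every wall constant
# `c ≥ 6/5`, UNCONDITIONALLY (crux `stmt-Ventures-19482`; lane poly-p2, gen 23)

Route `StickyWulffConstant` of the venture `Summits/Ventures/Crystal3D`, second prover lane.  Lane P's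
named fact `GenericTwoGrainInequality c` (`…GenericTwoGrainFact`, g18) — for every NON-co-axial pair of
crux frames `A, B` and every disjoint polyhedral finite-volume pair `S₁, S₂`,
`6·2^{1/3}(√2|S₁ ∪ S₂|)^{2/3} ≤ [Per_{W A} S₁ − ι_{W A}(S₁,S₂)] + [Per_{W B} S₂ − ι_{W B}(S₂,S₁)] +
c·ι_{Dsc 0}(S₁,S₂)` — holds WITH NO HYPOTHESIS for every `c ≥ 6/5`:

* `genericTwoGrainInequality_six_fifths` : the `n = 2` instance of the unconditional two-class rung
  `rung_twinFree_twoClasses_charged` (`…RungTwinFreeTwoClassesCharged`, this gen: overlap constant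
  `26.61` by inclusion–exclusion inside `B̄(0,2)`, balanced-case arithmetic at charge `6/5`).

LADDER OF THE GENERIC CONSTANT (kernel status after this gen): necessary `c ≥ √5 − √3 ≈ 0.504`
(P-GEN-g17 §1, wetting films; paper); V5 asks `13/25`; **proved unconditionally: `c ≥ 6/5`** (this file);
proved modulo the certified overlap constant CH-P1 (`WulffOverlap27_5`): `c ≥ 1`
(`genericTwoGrainInequality_of_WulffOverlap27_5`, this gen).
WHAT THIS IS NOT: anything below `6/5` without CH-P1; the multi-lattice class; the crux is not claimed.
-/

noncomputable section

open scoped BigOperators InnerProductSpace ENNReal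
open MeasureTheory Set

namespace Summit.Ventures.Crystal3D.Cruxes.PolycrystalWulffBound.PolyDensity

open Summit.Ventures.Crystal3D.Theorems
open Summit.Ventures.Crystal3D.Cruxes.TextureLiminf.TexShadow (E3)

/-- **`GenericTwoGrainInequality c` for every `c ≥ 6/5`, UNCONDITIONALLY.**  For a non-co-axial pair of
crux frames `(A, B)` and a disjoint polyhedral finite-volume pair `(S₁, S₂)`, the two-grain texture
`![S₁, S₂]` with frames `![A, B]`, all charges `c` and all axes `0` is a crux texture whose only distinct
pair is generic and charged `c ≥ 6/5`; `rung_twinFree_twoClasses_charged` applied to it is, after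
unfolding the `n = 2` sums, the conclusion of `GenericTwoGrainInequality c`.  No certificate, no named
fact. -/
theorem genericTwoGrainInequality_six_fifths {c : ℝ} (hc : 6 / 5 ≤ c) :
    GenericTwoGrainInequality c := by
  unfold GenericTwoGrainInequality
  intro Λ Brl Ax CoAx Φ Per ι W Dsc Poly A B hAB S₁ S₂ hP₁ hP₂ hv₁ hv₂ hd
  classical
  -- the two-grain texture
  set G : Fin 2 → Set E3 := ![S₁, S₂] with hG
  set A' : Fin 2 → (E3 ≃ₗᵢ[ℝ] E3) := ![A, B] with hA'
  have hG0 : G 0 = S₁ := rfl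
  have hG1 : G 1 = S₂ := rfl
  have hA0 : A' 0 = A := rfl
  have hA1 : A' 1 = B := rfl
  have h01 : (0 : Fin 2) ≠ 1 := by decide
  have hc1 : (1 : ℝ) ≤ c := le_trans (by norm_num) hc
  -- co-axiality is symmetric
  have hCoAx_symm : ∀ (X Y : E3 ≃ₗᵢ[ℝ] E3), CoAx X Y → CoAx Y X := by
    intro X Y hXY
    obtain ⟨m, L, s₁, s₂, σ, σ', hσ, hσ', hL, h1, h2⟩ := hXY
    exact ⟨m, L, s₂, s₁, σ', σ, hσ', hσ, hL, h2, h1⟩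
  -- no distinct pair of the texture is co-axial
  have hnc : ∀ f g : Fin 2, f ≠ g → ¬ CoAx (A' f) (A' g) := by
    intro f g hfg
    fin_cases f <;> fin_cases g
    · exact absurd rfl hfg
    · exact hAB
    · exact fun h => hAB (hCoAx_symm _ _ h)
    · exact absurd rfl hfg
  -- the texture clause
  have hTex : (∀ f : Fin 2, Literature.MathematicalPhysics.StatisticalMechanics.HasFinitePerimeter (G f) ∧
        volume (G f) < ⊤) ∧
      (∀ f g : Fin 2, f ≠ g → Disjoint (G f) (G g)) ∧
      (∀ f g : Fin 2, f ≠ g → (0 : ℝ) ≤ (fun _ _ : Fin 2 => c) f g) ∧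
      (∀ f g : Fin 2, f ≠ g → ¬ CoAx (A' f) (A' g) →
        (fun _ _ : Fin 2 => (0 : E3)) f g = 0 ∧ (1 : ℝ) ≤ (fun _ _ : Fin 2 => c) f g) ∧
      (∀ f g : Fin 2, f ≠ g → CoAx (A' f) (A' g) → A' f '' Λ ≠ A' g '' Λ →
        Ax ((fun _ _ : Fin 2 => (0 : E3)) f g) (A' f) (A' g) ∧ (1 : ℝ) / 2 ≤ (fun _ _ : Fin 2 => c) f g) := by
    refine ⟨?_, ?_, ?_, ?_, ?_⟩
    · intro f
      fin_cases f
      · exact ⟨hasFinitePerimeter_of_poly hP₁ hv₁, hv₁⟩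
      · exact ⟨hasFinitePerimeter_of_poly hP₂ hv₂, hv₂⟩
    · intro f g hfg
      fin_cases f <;> fin_cases g
      · exact absurd rfl hfg
      · exact hd
      · exact hd.symm
      · exact absurd rfl hfg
    · intro f g _
      show (0 : ℝ) ≤ c
      linarith
    · intro f g _ _
      exact ⟨rfl, hc1⟩
    · intro f g hfg hco _
      exact absurd hco (hnc f g hfg)
  have hPoly : ∀ f : Fin 2, Poly (G f) := by
    intro f
    fin_cases f
    · exact hP₁
    · exact hP₂
  have hTF : ∀ f g : Fin 2, f ≠ g → CoAx (A' f) (A' g) → A' f '' Λ = A' g '' Λ :=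
    fun f g hfg hco => absurd hco (hnc f g hfg)
  have hTwo : ∀ f g h : Fin 2, A' f '' Λ = A' g '' Λ ∨ A' g '' Λ = A' h '' Λ ∨ A' f '' Λ = A' h '' Λ := by
    intro f g h
    fin_cases f <;> fin_cases g <;> fin_cases h <;> simp
  have hCh : ∀ f g : Fin 2, f ≠ g → ¬ CoAx (A' f) (A' g) → (6 / 5 : ℝ) ≤ (fun _ _ : Fin 2 => c) f g :=
    fun f g _ _ => hc
  -- the charged two-class rung on the two-grain texture
  have key : 6 * (2 : ℝ) ^ ((1 : ℝ) / 3) * (Real.sqrt 2 * (volume (⋃ f : Fin 2, G f)).toReal) ^ ((2 : ℝ) / 3) ≤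
      ∑ f : Fin 2, Per (W (A' f)) (G f) -
        ∑ f : Fin 2, ∑ g : Fin 2, (if f = g then 0 else ι (W (A' f)) (G f) (G g)) +
        ∑ f : Fin 2, ∑ g : Fin 2,
          (if f = g then 0 else (fun _ _ : Fin 2 => c) f g / 2 *
            ι (Dsc ((fun _ _ : Fin 2 => (0 : E3)) f g)) (G f) (G g)) :=
    rung_twinFree_twoClasses_charged 2 G A' (fun _ _ => c) (fun _ _ => (0 : E3))
      hTex hPoly hTF hTwo hCh
  -- unfold the `n = 2` sums
  have hU : (⋃ f : Fin 2, G f) = S₁ ∪ S₂ := by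
    ext x
    simp only [Set.mem_iUnion, Fin.exists_fin_two, hG0, hG1, Set.mem_union]
  have hEn : (∑ f : Fin 2, Per (W (A' f)) (G f) -
        ∑ f : Fin 2, ∑ g : Fin 2, (if f = g then 0 else ι (W (A' f)) (G f) (G g)) +
        ∑ f : Fin 2, ∑ g : Fin 2,
          (if f = g then 0 else (fun _ _ : Fin 2 => c) f g / 2 *
            ι (Dsc ((fun _ _ : Fin 2 => (0 : E3)) f g)) (G f) (G g))) =
      (Per (W A) S₁ - ι (W A) S₁ S₂) + (Per (W B) S₂ - ι (W B) S₂ S₁) + c * ι (Dsc 0) S₁ S₂ := by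
    simp only [ι, Fin.sum_univ_two, Fin.isValue, if_true, if_false, h01, h01.symm, hG0, hG1, hA0, hA1,
      Set.union_comm S₂ S₁]
    ring
  rw [hU, hEn] at key
  exact key

end Summit.Ventures.Crystal3D.Cruxes.PolycrystalWulffBound.PolyDensity

end
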